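import Mathlib.Algebra.Group.ForwardDiff
import Mathlib.Algebra.Polynomial.FieldDivision
import Mathlib.Algebra.Polynomial.BigOperators
import Mathlib.Data.Nat.Choose.Basic
import Mathlib.Data.Nat.Factorial.BigOperators
import Mathlib.Tactic.LinearCombination
import Mathlib.Tactic.FieldSimp
import Mathlib.Tactic.Positivity
import HarnessLib

/-!
# Type-II Padé approximants to `Li₁, Li₂` at the two points `±1/z` — the algebra

Topic `Literature/NumberTheory/DiophantineApproximation`. This is the algebraic half of the proof of
the instance `K = ℚ`, `x = 0`, `r = m = 2`, `α = (1, −1)`, `β = N` of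
David–Hirata-Kohno–Kawashima, *Can polylogarithms at algebraic points be linearly independent?*,
Moscow J. Comb. Number Theory 9 (2020), Thm 2.1 (the `ℚ`-linear independence of
`1, Li₁(1/N), Li₂(1/N), Li₁(−1/N), Li₂(−1/N)` for large `N`, tree fact
`DHK2020_dilogTwoPointsLinearIndependent`, discharged in `DilogTwoPointsLinearIndependenceProofs.lean`).
Everything here is PROVED; there are no definitions and no named facts — the Padé data are written
out: with `A_{n,l}(T) = T^l (T² − 1)^{2n} = T^l (T−1)^{2n} (T+1)^{2n}` (coefficients `a_{l,k}`, taken in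
`ℤ[X]`) the type-II approximants of [DHK2020, §3, (P_{n,l}) with `S_{n,0}(T^k) = C(k+n,n) T^k`] are

  `P_{n,l}(z) = ∑_k p_{l,k} z^k`,  `p_{l,k} = C(k+n, n)² a_{l,k} ∈ ℤ`  (`0 ≤ l ≤ 4`, degree `4n + l`).

## Contents (following [DHK2020, §3 and §5])

* `sum_mul_coeff_mul_pow_eq_zero` — the mechanism of [DHK2020, Thm 3.6] in coefficient form: if
  `(X − α)^m ∣ A` and the weight `u` is a polynomial of degree `< m` (vanishing `m`-th forward
  difference), then `∑_k u(k) a_k α^k = 0` (induction on `m`: `A = (X − α)B` turns `u` into `Δu`).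
* `pade_orthogonality` — **the Padé property** [DHK2020, Thm 3.6]: for `j < n`, `s ∈ {1,2}`, `α = ±1`,
  `∑_k p_{l,k} α^{k+j+1}/(k+j+1)^s = 0`, i.e. `P_{n,l}(z) Li_s(α/z) − P_{n,l,α,s}(z) = O(z^{−n−1})`
  (the weight `C(k+n,n)²/(k+j+1)^s` is a polynomial in `k` of degree `≤ 2n − 1`,
  `exists_polynomial_choose_sq_div`, and `(X ∓ 1)^{2n} ∣ A_{n,l}`).
* `eq_zero_of_sum_div_eq_zero`, `moments_vanish_imp_zero` — **normality**: a polynomial of degree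
  `≤ 4n + 3` orthogonal to `t^j`, `t^j log(1/|t|)` (`j ≤ n`) on both `[0, 1]` and `[−1, 0]` vanishes.
  DEVIATION from the source: [DHK2020, Prop 5.1] proves the non-vanishing of the Padé determinant for
  general algebraic `α` through the closed evaluation [DHK2020, Lemma 5.2 + Prop 5.3] (whose proof is
  deferred there to the sequels [DHK1], [DHK2]); for the real instance `α = (1, −1)` we use instead the
  classical zero count: after the even/odd splitting the moment conditions say that the rational
  function `∑_a e_a/(Y + b_a)` (`≤ 2n+2` poles) has double zeros at `Y = 0, …, n`, so it vanishes.
* `pade_rows_independent`, `pade_rows_independent_inst` — **non-vanishing of the determinant**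
  [DHK2020, Prop 5.1] at every rational point `z`: the five rows
  `(P_{n,l}(z), P_{n,l,1,1}(z), P_{n,l,1,2}(z), P_{n,l,−1,1}(z), P_{n,l,−1,2}(z))`, `l = 0, …, 4`, with the
  polynomial parts `P_{n,l,α,s}(z) = ∑_k p_{l,k} ∑_{t<k} z^{k−1−t} α^{t+1}/(t+1)^s`, are linearly
  independent over `ℚ` (a vanishing combination `Q = ∑ c_l P_{n,l}` has `Q(z) = 0`; summation by parts
  moves the orthogonality, now for all `j ≤ n`, to `Q/(T − z)`, which is then `0` by normality; the
  degrees `4n + l` are distinct).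

The analytic half (remainder series and bounds, the denominators `lcm(1..4n+4)²`, the criterion
[DHK2020, Prop 4.2] for `K = ℚ`, and the assembly) is in `DilogTwoPointsLinearIndependenceProofs.lean`.

References: S. David, N. Hirata-Kohno, M. Kawashima, Moscow J. Comb. Number Theory 9:4 (2020)
389–406 = arXiv:1912.03811, §3 (Lemma 3.1, Notation 3.3–3.4, (P_{n,l}), Thm 3.6), §5 (Prop 5.1,
Lemma 5.2, Prop 5.3) [DavidHirataKohnoKawashima2020]; E. M. Nikišin, Mat. Sb. 109 (1979) (the
`AT`-property of `1, log`); G. Rhin, P. Toffin, J. Number Theory 24 (1986) (several points).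
-/

noncomputable section

open Finset Polynomial fwdDiff

namespace Literature.NumberTheory.DiophantineApproximation

namespace DilogTwoPoints

/-- **Orthogonality from a high-order zero** (the mechanism behind the Padé property of
[DavidHirataKohnoKawashima2020, Thm 3.6], in coefficient form): if `(X − α)^m ∣ A` and
`u : ℚ → ℚ` has vanishing `m`-th forward difference (e.g. `u` is a polynomial of degree `< m`),
then `∑_k u(k) a_k α^k = 0`, where `a_k` are the coefficients of `A`. Proof: write
`A = (X − α) B`; then `∑_k u(k) a_k α^k = α ∑_k (Δu)(k) b_k α^k`, and induct on `m`. [folklore] -/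
theorem sum_mul_coeff_mul_pow_eq_zero (α : ℚ) :
    ∀ (m : ℕ) {A : ℚ[X]} {d : ℕ} {u : ℚ → ℚ}, (X - C α) ^ m ∣ A → A.natDegree < d →
      Δ_[1]^[m] u = 0 → ∑ k ∈ range d, u k * A.coeff k * α ^ k = 0
  | 0, A, d, u, _, _, hu => by
      simp only [Function.iterate_zero, id_eq] at hu
      simp [hu]
  | m + 1, A, d, u, hA, hd, hu => by
      obtain ⟨B', hB'⟩ := hA
      set B : ℚ[X] := (X - C α) ^ m * B' with hB
      have hAB : A = (X - C α) * B := by rw [hB', hB, ← mul_assoc, ← pow_succ']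
      have hBdvd : (X - C α) ^ m ∣ B := ⟨B', rfl⟩
      -- the forward difference of `u` has vanishing `m`-th difference
      have hu' : Δ_[1]^[m] (Δ_[1] u) = 0 := by
        rw [← Function.iterate_succ_apply, hu]
      by_cases hB0 : B = 0
      · rw [hAB, hB0, mul_zero]
        simp
      -- degrees: `natDegree A = natDegree B + 1 < d`, so `d = d' + 1` with `natDegree B < d'`
      have hdegA : A.natDegree = B.natDegree + 1 := by
        rw [hAB, natDegree_mul (X_sub_C_ne_zero α) hB0, natDegree_X_sub_C, add_comm]
      obtain ⟨d', rfl⟩ : ∃ d', d = d' + 1 := ⟨d - 1, by omega⟩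
      have hd' : B.natDegree < d' := by omega
      have IH := sum_mul_coeff_mul_pow_eq_zero α m hBdvd hd' hu'
      -- coefficients of `A = (X - C α) B`
      have hc0 : A.coeff 0 = -(α * B.coeff 0) := by
        rw [hAB, sub_mul, coeff_sub, coeff_X_mul_zero, coeff_C_mul, zero_sub]
      have hcs : ∀ k, A.coeff (k + 1) = B.coeff k - α * B.coeff (k + 1) := by
        intro k
        rw [hAB, sub_mul, coeff_sub, coeff_X_mul, coeff_C_mul]
      have htop : B.coeff d' = 0 := coeff_eq_zero_of_natDegree_lt hd'
      -- the shifted sum `∑_{k<d'+1} u k B_k α^{k+1}` computed in two ways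
      have h2 : ∑ k ∈ range d', u (k + 1 : ℕ) * B.coeff (k + 1) * α ^ (k + 2) +
          u (0 : ℕ) * B.coeff 0 * α = ∑ k ∈ range d', u k * B.coeff k * α ^ (k + 1) := by
        have e1 : ∑ k ∈ range (d' + 1), u k * B.coeff k * α ^ (k + 1) =
            ∑ k ∈ range d', u (k + 1 : ℕ) * B.coeff (k + 1) * α ^ (k + 2) +
              u (0 : ℕ) * B.coeff 0 * α := by
          rw [sum_range_succ']
          simp
        rw [← e1, sum_range_succ, htop]
        ring
      have hΔ : ∀ k : ℕ, Δ_[1] u k = u (k + 1 : ℕ) - u k := fun k => by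
        simp [fwdDiff]
      simp only [hΔ] at IH
      -- `T1 - T2` form of the main sum
      have h1 : ∑ k ∈ range d', u (k + 1 : ℕ) * (B.coeff k - α * B.coeff (k + 1)) * α ^ (k + 1) =
          ∑ k ∈ range d', u (k + 1 : ℕ) * B.coeff k * α ^ (k + 1) -
            ∑ k ∈ range d', u (k + 1 : ℕ) * B.coeff (k + 1) * α ^ (k + 2) := by
        rw [← sum_sub_distrib]
        exact sum_congr rfl fun k _ => by ring
      have h3 : ∑ k ∈ range d', u (k + 1 : ℕ) * B.coeff k * α ^ (k + 1) -
          ∑ k ∈ range d', u k * B.coeff k * α ^ (k + 1) =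
          α * ∑ k ∈ range d', (u (k + 1 : ℕ) - u k) * B.coeff k * α ^ k := by
        rw [← sum_sub_distrib, mul_sum]
        exact sum_congr rfl fun k _ => by ring
      rw [sum_range_succ']
      simp only [hcs, hc0, pow_zero, mul_one]
      rw [h1]
      linear_combination (-1 : ℚ) * h2 + h3 + α * IH

/-- The weights `u_{j,s}(k) = C(k+n, n)² / (k+j+1)^s` (`j < n`, `s ∈ {1, 2}`) are polynomials in
`k` of degree `< 2n`: `(k+j+1)` divides `(k+1)(k+2)⋯(k+n) = n!·C(k+n,n)`. [folklore] -/
theorem exists_polynomial_choose_sq_div {n j s : ℕ} (hj : j < n) (hs1 : 1 ≤ s) (hs2 : s ≤ 2) :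
    ∃ U : ℚ[X], U.natDegree < 2 * n ∧
      ∀ k : ℕ, U.eval (k : ℚ) = ((k + n).choose n : ℚ) ^ 2 / ((k : ℚ) + j + 1) ^ s := by
  classical
  refine ⟨C ((n.factorial : ℚ)⁻¹ ^ 2) * ((X + C ((j : ℚ) + 1)) ^ (2 - s) *
      ∏ i ∈ (range n).erase j, (X + C ((i : ℚ) + 1)) ^ 2), ?_, ?_⟩
  · -- degree `≤ (2 - s) + 2 (n - 1) < 2n`
    have hcard : ((range n).erase j).card = n - 1 := by
      rw [card_erase_of_mem (mem_range.2 hj), card_range]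
    have h1 : ((X + C ((j : ℚ) + 1)) ^ (2 - s)).natDegree ≤ 2 - s := by
      refine (natDegree_pow_le).trans ?_
      rw [natDegree_X_add_C, mul_one]
    have h2 : (∏ i ∈ (range n).erase j, (X + C ((i : ℚ) + 1)) ^ 2).natDegree ≤ 2 * (n - 1) := by
      refine (natDegree_prod_le _ _).trans ?_
      have hle : ∀ i ∈ (range n).erase j, ((X + C ((i : ℚ) + 1)) ^ 2).natDegree ≤ 2 := by
        intro i _
        refine (natDegree_pow_le).trans ?_
        rw [natDegree_X_add_C, mul_one]
      refine (sum_le_card_nsmul _ _ 2 hle).trans ?_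
      rw [hcard, smul_eq_mul]
      omega
    refine (natDegree_C_mul_le _ _).trans_lt ?_
    refine (natDegree_mul_le).trans_lt ?_
    omega
  · intro k
    have hfac : (n.factorial : ℚ) ≠ 0 := by exact_mod_cast n.factorial_ne_zero
    -- `n! * C(k+n, n) = ∏_{i<n} (k+1+i)`
    have hprod : ((n.factorial : ℚ)) * ((k + n).choose n : ℚ) =
        ∏ i ∈ range n, ((k : ℚ) + 1 + i) := by
      have h := Nat.ascFactorial_eq_factorial_mul_choose k n
      rw [Nat.ascFactorial_eq_prod_range] at h
      have h' := congrArg (Nat.cast (R := ℚ)) h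
      push_cast at h'
      rw [← h']
    have hsplit : ∏ i ∈ range n, ((k : ℚ) + 1 + i) =
        ((k : ℚ) + j + 1) * ∏ i ∈ (range n).erase j, ((k : ℚ) + 1 + i) := by
      rw [← mul_prod_erase (range n) (fun i => (k : ℚ) + 1 + i) (mem_range.2 hj)]
      ring
    have hkj : ((k : ℚ) + j + 1) ≠ 0 := by positivity
    have hchoose : ((k + n).choose n : ℚ) =
        (n.factorial : ℚ)⁻¹ * (((k : ℚ) + j + 1) * ∏ i ∈ (range n).erase j, ((k : ℚ) + 1 + i)) := by
      rw [← hsplit, ← hprod, ← mul_assoc, inv_mul_cancel₀ hfac, one_mul]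
    rw [hchoose, eval_mul, eval_C, eval_mul, eval_pow, eval_prod]
    simp only [eval_pow, eval_add, eval_X, eval_C]
    rw [eq_div_iff (pow_ne_zero _ hkj)]
    have hs : 2 - s + s = 2 := by omega
    calc ((n.factorial : ℚ))⁻¹ ^ 2 *
          (((k : ℚ) + ((j : ℚ) + 1)) ^ (2 - s) * ∏ i ∈ (range n).erase j, ((k : ℚ) + ((i : ℚ) + 1)) ^ 2) *
          ((k : ℚ) + j + 1) ^ s
        = ((n.factorial : ℚ))⁻¹ ^ 2 * (((k : ℚ) + j + 1) ^ (2 - s) * ((k : ℚ) + j + 1) ^ s) *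
            ∏ i ∈ (range n).erase j, ((k : ℚ) + 1 + i) ^ 2 := by
          rw [show (k : ℚ) + ((j : ℚ) + 1) = (k : ℚ) + j + 1 by ring]
          rw [show (∏ i ∈ (range n).erase j, ((k : ℚ) + ((i : ℚ) + 1)) ^ 2) =
            ∏ i ∈ (range n).erase j, ((k : ℚ) + 1 + i) ^ 2 from
              prod_congr rfl fun i _ => by ring]
          ring
      _ = ((n.factorial : ℚ)⁻¹ * (((k : ℚ) + j + 1) *
            ∏ i ∈ (range n).erase j, ((k : ℚ) + 1 + i))) ^ 2 := by
          rw [← pow_add, hs, prod_pow]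
          ring

/-- The base polynomial `A_{n,l} = T^l (T² − 1)^{2n} = T^l (T − 1)^{2n} (T + 1)^{2n}` of the
type-II Padé construction of [DavidHirataKohnoKawashima2020, §3] for `m = r = 2`, `α = (1, −1)`,
mapped to `ℚ[X]`. [cite: DavidHirataKohnoKawashima2020, §3 (A_{n,l})] -/
theorem map_basePoly (n l : ℕ) :
    (X ^ l * (X ^ 2 - 1) ^ (2 * n) : ℤ[X]).map (Int.castRingHom ℚ) =
      (X ^ l * (X ^ 2 - 1) ^ (2 * n) : ℚ[X]) := by
  simp [Polynomial.map_mul, Polynomial.map_pow, Polynomial.map_sub]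

/-- Coefficients of the base polynomial: the integer ones cast to `ℚ` are the rational ones.
[folklore] -/
theorem cast_coeff_basePoly (n l k : ℕ) :
    (((X ^ l * (X ^ 2 - 1) ^ (2 * n) : ℤ[X]).coeff k : ℤ) : ℚ) =
      (X ^ l * (X ^ 2 - 1) ^ (2 * n) : ℚ[X]).coeff k := by
  rw [← map_basePoly, coeff_map, eq_intCast]

/-- The base polynomial has degree at most `l + 4n`. [folklore] -/
theorem natDegree_basePoly_le (n l : ℕ) :
    (X ^ l * (X ^ 2 - 1) ^ (2 * n) : ℚ[X]).natDegree ≤ l + 4 * n := by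
  refine natDegree_mul_le.trans ?_
  rw [natDegree_X_pow]
  refine Nat.add_le_add_left ?_ _
  refine natDegree_pow_le.trans ?_
  have h : (X ^ 2 - 1 : ℚ[X]).natDegree ≤ 2 := by
    refine (natDegree_sub_le _ _).trans ?_
    rw [natDegree_X_pow, natDegree_one]
    simp
  calc 2 * n * (X ^ 2 - 1 : ℚ[X]).natDegree ≤ 2 * n * 2 := Nat.mul_le_mul_left _ h
    _ = 4 * n := by ring

/-- `(X − α)^{2n}` divides the base polynomial for `α = ±1`. [folklore] -/
theorem X_sub_C_pow_dvd_basePoly (n l : ℕ) {α : ℚ} (hα : α = 1 ∨ α = -1) :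
    (X - C α) ^ (2 * n) ∣ (X ^ l * (X ^ 2 - 1) ^ (2 * n) : ℚ[X]) := by
  have hfac : (X ^ 2 - 1 : ℚ[X]) = (X - C 1) * (X - C (-1)) := by
    simp only [map_one, map_neg, sub_neg_eq_add]
    ring
  rw [hfac, mul_pow]
  rcases hα with rfl | rfl
  · exact Dvd.intro_left (X ^ l * (X - C (-1)) ^ (2 * n)) (by ring)
  · exact Dvd.intro_left (X ^ l * (X - C 1) ^ (2 * n)) (by ring)

/-- **Padé property** (orthogonality) of the type-II approximants
`P_{n,l}(z) = ∑_k C(k+n,n)² a_k z^k`, `a_k` the coefficients of `T^l (T² − 1)^{2n}`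
([DavidHirataKohnoKawashima2020, Thm 3.6] for `x = 0`, `r = m = 2`, `α = (1, −1)`): for `j < n`,
`s ∈ {1, 2}` and `α = ±1`, `∑_k C(k+n,n)² a_k α^{k+j+1}/(k+j+1)^s = 0` — i.e. the coefficient of
`z^{−j−1}` in `P_{n,l}(z) Li_s(α/z) − P_{n,l,α,s}(z)` vanishes for `j < n`. The paper proves this with
the operator identities `S_n = S_1 ∘ ⋯ ∘ (S_1 + n − 1)/n!`, `[T^k] ∘ S_1 = (S_1 − k) ∘ [T^k]` and
Leibniz; here the same mechanism is run in coefficient form (`sum_mul_coeff_mul_pow_eq_zero` with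
the polynomial weight `C(k+n,n)²/(k+j+1)^s` of degree `< 2n`). [cite: DavidHirataKohnoKawashima2020, Thm 3.6] -/
theorem pade_orthogonality (n l : ℕ) (hl : l ≤ 4) {j : ℕ} (hj : j < n) {s : ℕ} (hs1 : 1 ≤ s)
    (hs2 : s ≤ 2) {α : ℚ} (hα : α = 1 ∨ α = -1) :
    ∑ k ∈ range (4 * n + 5),
      (((X ^ l * (X ^ 2 - 1) ^ (2 * n) : ℤ[X]).coeff k : ℤ) : ℚ) * ((k + n).choose n : ℚ) ^ 2 *
        α ^ (k + j + 1) / ((k : ℚ) + j + 1) ^ s = 0 := by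
  obtain ⟨U, hUdeg, hU⟩ := exists_polynomial_choose_sq_div hj hs1 hs2
  have hΔ : Δ_[1]^[2 * n] U.eval = 0 := Polynomial.fwdDiff_iter_eq_zero_of_degree_lt hUdeg
  have hdeg : (X ^ l * (X ^ 2 - 1) ^ (2 * n) : ℚ[X]).natDegree < 4 * n + 5 :=
    (natDegree_basePoly_le n l).trans_lt (by omega)
  have key := sum_mul_coeff_mul_pow_eq_zero α (2 * n) (X_sub_C_pow_dvd_basePoly n l hα) hdeg hΔ
  have hterm : ∀ k ∈ range (4 * n + 5),
      (((X ^ l * (X ^ 2 - 1) ^ (2 * n) : ℤ[X]).coeff k : ℤ) : ℚ) * ((k + n).choose n : ℚ) ^ 2 *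
        α ^ (k + j + 1) / ((k : ℚ) + j + 1) ^ s =
      α ^ (j + 1) * (U.eval (k : ℚ) * (X ^ l * (X ^ 2 - 1) ^ (2 * n) : ℚ[X]).coeff k * α ^ k) := by
    intro k _
    rw [cast_coeff_basePoly, hU k]
    have hkj : ((k : ℚ) + j + 1) ≠ 0 := by positivity
    field_simp
    ring
  rw [sum_congr rfl hterm, ← mul_sum, key, mul_zero]

/-! ## Normality: a polynomial with too many vanishing moments is zero -/

/-- **Zero counting for `∑_a e_a/(Y + b_a)`**: if `M ≤ 2(n+1)` numbers `e_a` satisfy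
`∑_a e_a/(b_a + j) = 0` and `∑_a e_a/(b_a + j)² = 0` for `j = 0, …, n` (distinct positive `b_a`),
then all `e_a` vanish — the rational function `∑_a e_a/(Y + b_a)` has the `n + 1` double zeros
`Y = 0, …, n` but a numerator of degree `≤ M − 1 < 2(n+1)`. (This replaces, for the instance at
hand, the general non-vanishing argument of [DavidHirataKohnoKawashima2020, Prop 5.1/5.3].)
[folklore] -/
theorem eq_zero_of_sum_div_eq_zero {M n : ℕ} (hM : M ≤ 2 * (n + 1)) {b : ℕ → ℚ}
    (hb : ∀ a, 0 < b a) (hinj : Set.InjOn b (range M)) {e : ℕ → ℚ}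
    (h1 : ∀ j ≤ n, ∑ a ∈ range M, e a / (b a + j) = 0)
    (h2 : ∀ j ≤ n, ∑ a ∈ range M, e a / (b a + j) ^ 2 = 0) :
    ∀ a ∈ range M, e a = 0 := by
  classical
  -- the numerator `G = ∑_a e_a ∏_{a' ≠ a} (Y + b_{a'})`, of degree `≤ M - 1`
  set G : ℚ[X] := ∑ a ∈ range M, C (e a) * ∏ a' ∈ (range M).erase a, (X + C (b a')) with hG
  have hne : ∀ (j a : ℕ), ((j : ℚ) + b a) ≠ 0 := fun j a => by have := hb a; positivity
  have hprod_erase : ∀ (j : ℕ) (a : ℕ), a ∈ range M →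
      ∏ a' ∈ (range M).erase a, ((j : ℚ) + b a') =
        (∏ a' ∈ range M, ((j : ℚ) + b a')) / ((j : ℚ) + b a) := by
    intro j a ha
    rw [eq_div_iff (hne j a), mul_comm]
    exact mul_prod_erase (range M) (fun a' => (j : ℚ) + b a') ha
  -- Step 1: `G(j) = 0`
  have hroot : ∀ j ≤ n, G.IsRoot (j : ℚ) := by
    intro j hj
    rw [IsRoot, hG, eval_finsetSum]
    simp only [eval_mul, eval_C, eval_prod, eval_add, eval_X]
    calc ∑ a ∈ range M, e a * ∏ a' ∈ (range M).erase a, ((j : ℚ) + b a')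
        = (∏ a' ∈ range M, ((j : ℚ) + b a')) * ∑ a ∈ range M, e a / (b a + j) := by
          rw [mul_sum]
          refine sum_congr rfl fun a ha => ?_
          rw [hprod_erase j a ha, add_comm (b a)]
          ring
      _ = 0 := by rw [h1 j hj, mul_zero]
  -- Step 2: `G'(j) = 0`
  have hroot' : ∀ j ≤ n, G.derivative.IsRoot (j : ℚ) := by
    intro j hj
    set Pj := ∏ a' ∈ range M, ((j : ℚ) + b a') with hPj
    set Hj := ∑ a' ∈ range M, 1 / ((j : ℚ) + b a') with hHj
    clear_value Pj Hj
    have hinner : ∀ a ∈ range M,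
        ∑ a'' ∈ (range M).erase a, ∏ a' ∈ ((range M).erase a).erase a'', ((j : ℚ) + b a') =
          Pj / ((j : ℚ) + b a) * (Hj - 1 / ((j : ℚ) + b a)) := by
      intro a ha
      rw [hHj, ← sum_erase_eq_sub (f := fun a' => 1 / ((j : ℚ) + b a')) ha, mul_sum]
      refine sum_congr rfl fun a'' ha'' => ?_
      have hsplit := mul_prod_erase ((range M).erase a) (fun a' => (j : ℚ) + b a') ha''
      rw [hprod_erase j a ha, ← hPj] at hsplit
      rw [← hsplit]
      field_simp [hne j a'']
    rw [IsRoot, hG, derivative_sum, eval_finsetSum]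
    simp only [derivative_mul, derivative_C, zero_mul, zero_add, derivative_prod_finset,
      derivative_add, derivative_X, derivative_C, add_zero, mul_one, eval_mul, eval_C,
      eval_finsetSum, eval_prod, eval_add, eval_X]
    calc ∑ a ∈ range M, e a *
          ∑ a'' ∈ (range M).erase a, ∏ a' ∈ ((range M).erase a).erase a'', ((j : ℚ) + b a')
        = ∑ a ∈ range M, (Pj * Hj * (e a / (b a + j)) - Pj * (e a / (b a + j) ^ 2)) := by
          refine sum_congr rfl fun a ha => ?_
          rw [hinner a ha]
          have hx : (b a + j : ℚ) ≠ 0 := by rw [add_comm]; exact hne j a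
          have hx' : ((j : ℚ) + b a) ≠ 0 := hne j a
          field_simp
          ring
      _ = Pj * Hj * ∑ a ∈ range M, e a / (b a + j) - Pj * ∑ a ∈ range M, e a / (b a + j) ^ 2 := by
          rw [sum_sub_distrib, mul_sum, mul_sum]
      _ = 0 := by rw [h1 j hj, h2 j hj, mul_zero, mul_zero, sub_zero]
  -- Step 3: if some `e_a ≠ 0` then `G ≠ 0` (evaluate at `-b_a`) and `G` has too many roots
  intro a ha
  by_contra hea
  have hG0 : G ≠ 0 := by
    intro h0
    have hev : G.eval (-b a) = e a * ∏ a' ∈ (range M).erase a, (-b a + b a') := by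
      rw [hG, eval_finsetSum]
      simp only [eval_mul, eval_C, eval_prod, eval_add, eval_X]
      refine sum_eq_single a (fun a'' ha'' hne' => ?_) (fun h => absurd ha h)
      rw [prod_eq_zero (mem_erase.2 ⟨Ne.symm hne', ha⟩) (by ring), mul_zero]
    have hprod : ∏ a' ∈ (range M).erase a, (-b a + b a') ≠ 0 := by
      refine prod_ne_zero_iff.2 fun a' ha' => ?_
      have hne' : b a' ≠ b a := fun h => (mem_erase.1 ha').1 (hinj (mem_erase.1 ha').2 ha h)
      intro h
      apply hne'
      linarith
    have : G.eval (-b a) = 0 := by rw [h0, eval_zero]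
    rw [hev] at this
    exact hea ((mul_eq_zero.1 this).resolve_right hprod)
  -- root multiplicities `≥ 2` at `j = 0, …, n`
  have hdvd : ∀ j ∈ range (n + 1), (X - C (j : ℚ)) ^ 2 ∣ G := by
    intro j hj
    have hj' : j ≤ n := by have := mem_range.1 hj; omega
    exact (le_rootMultiplicity_iff hG0).1
      ((one_lt_rootMultiplicity_iff_isRoot hG0).2 ⟨hroot j hj', hroot' j hj'⟩)
  have hcop : Set.Pairwise (↑(range (n + 1)) : Set ℕ)
      (Function.onFun IsCoprime fun j : ℕ => (X - C (j : ℚ)) ^ 2) := by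
    intro i _ j _ hij
    exact (pairwise_coprime_X_sub_C (Nat.cast_injective (R := ℚ)) hij).pow
  have hdvd' := Finset.prod_dvd_of_coprime hcop hdvd
  have hdeg_prod : (∏ j ∈ range (n + 1), (X - C (j : ℚ)) ^ 2).natDegree = 2 * (n + 1) := by
    rw [natDegree_prod_of_monic _ _ (fun j _ => (monic_X_sub_C _).pow 2)]
    simp only [natDegree_pow, natDegree_X_sub_C, mul_one, sum_const, card_range, smul_eq_mul]
    ring
  have hdegG : G.natDegree ≤ M - 1 := by
    rw [hG]
    refine natDegree_sum_le_of_forall_le _ _ fun a' ha' => ?_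
    refine (natDegree_C_mul_le _ _).trans ?_
    refine (natDegree_prod_le _ _).trans ?_
    have hle : ∀ i ∈ (range M).erase a', (X + C (b i)).natDegree ≤ 1 := fun i _ => by
      rw [natDegree_X_add_C]
    refine (sum_le_card_nsmul _ _ 1 hle).trans ?_
    rw [card_erase_of_mem ha', card_range, smul_eq_mul, mul_one]
  have := natDegree_le_of_dvd hdvd' hG0
  rw [hdeg_prod] at this
  have hM1 : 1 ≤ M := by have := mem_range.1 ha; omega
  omega

/-- Splitting a sum over `range (2M)` into even and odd indices. [folklore] -/
theorem sum_range_two_mul {β : Type*} [AddCommMonoid β] (f : ℕ → β) (M : ℕ) :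
    ∑ k ∈ range (2 * M), f k = ∑ a ∈ range M, (f (2 * a) + f (2 * a + 1)) := by
  induction M with
  | zero => simp
  | succ M ih =>
      rw [show 2 * (M + 1) = 2 * M + 1 + 1 by ring, sum_range_succ, sum_range_succ, ih,
        sum_range_succ, add_assoc]

/-- **Normality** of the two-point dilogarithmic moment problem: if `q_0, …, q_{4n+3}` satisfy
`∑_k q_k α^{k+j+1}/(k+j+1)^s = 0` for all `j ≤ n`, `s ∈ {1,2}`, `α = ±1` — i.e. the polynomial
`∑ q_k T^k` is orthogonal to `t^j` and `t^j log(1/|t|)` (`j ≤ n`) on both `[0,1]` and `[−1,0]` —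
then all `q_k` vanish. Proof: splitting into even and odd `k` decouples the two signs, and each
half is `eq_zero_of_sum_div_eq_zero` with `b_a = 2a+1`, resp. `2a+2`. This is the non-vanishing of
the Padé determinant [DavidHirataKohnoKawashima2020, Prop 5.1] for the instance `x = 0`,
`r = m = 2`, `α = (1,−1)`, obtained here by zero counting instead of the closed formula of
[DavidHirataKohnoKawashima2020, Prop 5.3]. [cite: DavidHirataKohnoKawashima2020, Prop 5.1] -/
theorem moments_vanish_imp_zero (n : ℕ) {q : ℕ → ℚ}
    (h : ∀ j ≤ n, ∀ s : ℕ, (s = 1 ∨ s = 2) → ∀ α : ℚ, (α = 1 ∨ α = -1) →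
      ∑ k ∈ range (4 * n + 4), q k * α ^ (k + j + 1) / ((k : ℚ) + j + 1) ^ s = 0) :
    ∀ k < 4 * n + 4, q k = 0 := by
  -- even / odd moment sums
  have hEO : ∀ j ≤ n, ∀ s : ℕ, (s = 1 ∨ s = 2) →
      (∑ a ∈ range (2 * (n + 1)), q (2 * a) / (2 * (a : ℚ) + 1 + j) ^ s = 0) ∧
      (∑ a ∈ range (2 * (n + 1)), q (2 * a + 1) / (2 * (a : ℚ) + 2 + j) ^ s = 0) := by
    intro j hj s hs
    have hp := h j hj s hs 1 (Or.inl rfl)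
    have hm := h j hj s hs (-1) (Or.inr rfl)
    rw [show 4 * n + 4 = 2 * (2 * (n + 1)) by ring, sum_range_two_mul] at hp hm
    set σ : ℚ := (-1) ^ (j + 1) with hσ
    have hσ0 : σ ≠ 0 := pow_ne_zero _ (by norm_num)
    have e1 : ∀ a : ℕ, (-1 : ℚ) ^ (2 * a + j + 1) = σ := fun a => by
      rw [hσ, add_assoc, pow_add, pow_mul]; norm_num
    have e2 : ∀ a : ℕ, (-1 : ℚ) ^ (2 * a + 1 + j + 1) = -σ := fun a => by
      rw [hσ, show 2 * a + 1 + j + 1 = 2 * a + (j + 1) + 1 by ring, pow_succ, pow_add, pow_mul]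
      norm_num
    set E := ∑ a ∈ range (2 * (n + 1)), q (2 * a) / (2 * (a : ℚ) + 1 + j) ^ s with hE
    set O := ∑ a ∈ range (2 * (n + 1)), q (2 * a + 1) / (2 * (a : ℚ) + 2 + j) ^ s with hO
    have hp' : E + O = 0 := by
      rw [hE, hO, ← sum_add_distrib, ← hp]
      refine sum_congr rfl fun a _ => ?_
      push_cast
      ring_nf
    have hm' : σ * (E - O) = 0 := by
      rw [hE, hO, mul_sub, mul_sum, mul_sum, ← sum_sub_distrib, ← hm]
      refine sum_congr rfl fun a _ => ?_
      rw [e1, e2]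
      push_cast
      ring_nf
    have hEO' : E - O = 0 := (mul_eq_zero.1 hm').resolve_left hσ0
    constructor <;> linarith
  have hbE : ∀ a : ℕ, (0 : ℚ) < 2 * (a : ℚ) + 1 := fun a => by positivity
  have hbO : ∀ a : ℕ, (0 : ℚ) < 2 * (a : ℚ) + 2 := fun a => by positivity
  have hinjE : Set.InjOn (fun a : ℕ => 2 * (a : ℚ) + 1) (range (2 * (n + 1))) := by
    intro a _ a' _ h
    have : (a : ℚ) = a' := by simp only at h; linarith
    exact_mod_cast this
  have hinjO : Set.InjOn (fun a : ℕ => 2 * (a : ℚ) + 2) (range (2 * (n + 1))) := by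
    intro a _ a' _ h
    have : (a : ℚ) = a' := by simp only at h; linarith
    exact_mod_cast this
  have hEven := eq_zero_of_sum_div_eq_zero (le_refl (2 * (n + 1))) hbE hinjE
    (e := fun a => q (2 * a))
    (fun j hj => by simpa using (hEO j hj 1 (Or.inl rfl)).1)
    (fun j hj => by simpa using (hEO j hj 2 (Or.inr rfl)).1)
  have hOdd := eq_zero_of_sum_div_eq_zero (le_refl (2 * (n + 1))) hbO hinjO
    (e := fun a => q (2 * a + 1))
    (fun j hj => by simpa using (hEO j hj 1 (Or.inl rfl)).2)
    (fun j hj => by simpa using (hEO j hj 2 (Or.inr rfl)).2)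
  intro k hk
  obtain ⟨a, rfl | rfl⟩ := Nat.even_or_odd' k
  · exact hEven a (mem_range.2 (by omega))
  · exact hOdd a (mem_range.2 (by omega))

/-! ## Non-vanishing of the Padé determinant (row independence) -/

/-- Coefficients of `(X − z) G` against a weight `v`: a summation by parts. [folklore] -/
theorem sum_coeff_X_sub_C_mul (G : ℚ[X]) (z : ℚ) (v : ℕ → ℚ) (K : ℕ) :
    ∑ k ∈ range (K + 1), ((X - C z) * G).coeff k * v k =
      ∑ k ∈ range K, G.coeff k * v (k + 1) - z * ∑ k ∈ range (K + 1), G.coeff k * v k := by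
  have hc0 : ((X - C z) * G).coeff 0 = -(z * G.coeff 0) := by
    rw [sub_mul, coeff_sub, coeff_X_mul_zero, coeff_C_mul, zero_sub]
  have hcs : ∀ k, ((X - C z) * G).coeff (k + 1) = G.coeff k - z * G.coeff (k + 1) := fun k => by
    rw [sub_mul, coeff_sub, coeff_X_mul, coeff_C_mul]
  rw [sum_range_succ', sum_range_succ']
  simp only [hcs, hc0]
  have h : ∑ k ∈ range K, (G.coeff k - z * G.coeff (k + 1)) * v (k + 1) =
      ∑ k ∈ range K, G.coeff k * v (k + 1) - z * ∑ k ∈ range K, G.coeff (k + 1) * v (k + 1) := by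
    rw [mul_sum, ← sum_sub_distrib]
    exact sum_congr rfl fun k _ => by ring
  rw [h]
  ring

/-- **Row independence of the Padé system** (the non-vanishing of the determinant `Δ_n` of
[DavidHirataKohnoKawashima2020, Prop 5.1], for `x = 0`, `r = m = 2`, `α = (1,−1)`, at every
rational point `z`). Let `P_l(T) = ∑_k p_{l,k} T^k` (`l = 0, …, 4`) have exact degree `4n + l` and
the Padé orthogonality `∑_k p_{l,k} α^{k+j+1}/(k+j+1)^s = 0` (`j < n`, `s ∈ {1,2}`, `α = ±1`), and
let `P_{l,α,s}(z) = ∑_k p_{l,k} ∑_{t<k} z^{k−1−t} α^{t+1}/(t+1)^s` be the polynomial parts. Then the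
five vectors `(P_l(z), P_{l,1,1}(z), P_{l,1,2}(z), P_{l,−1,1}(z), P_{l,−1,2}(z))` are linearly
independent over `ℚ`. Proof: a vanishing combination `Q = ∑ c_l P_l` has `Q(z) = 0`, so
`Q = (T − z) Q̂`; summation by parts transfers the orthogonality (now for `j ≤ n`) to `Q̂`, which
has degree `≤ 4n + 3`, so `Q̂ = 0` by `moments_vanish_imp_zero`; the degrees `4n + l` being
distinct, `c = 0`. [cite: DavidHirataKohnoKawashima2020, Prop 5.1] -/
theorem pade_rows_independent (n : ℕ) {p : ℕ → ℕ → ℚ}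
    (horth : ∀ l ≤ 4, ∀ j < n, ∀ s : ℕ, (s = 1 ∨ s = 2) → ∀ α : ℚ, (α = 1 ∨ α = -1) →
      ∑ k ∈ range (4 * n + 5), p l k * α ^ (k + j + 1) / ((k : ℚ) + j + 1) ^ s = 0)
    (hlead : ∀ l ≤ 4, p l (4 * n + l) ≠ 0)
    (hvanish : ∀ l ≤ 4, ∀ k, 4 * n + l < k → p l k = 0)
    (z : ℚ) (c : Fin 5 → ℚ)
    (hP : ∑ l : Fin 5, c l * ∑ k ∈ range (4 * n + 5), p l k * z ^ k = 0)
    (hQ : ∀ α : ℚ, (α = 1 ∨ α = -1) → ∀ s : ℕ, (s = 1 ∨ s = 2) →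
      ∑ l : Fin 5, c l * ∑ k ∈ range (4 * n + 5), p l k *
        ∑ t ∈ range k, z ^ (k - 1 - t) * α ^ (t + 1) / ((t : ℚ) + 1) ^ s = 0) :
    c = 0 := by
  classical
  have hl4 : ∀ l : Fin 5, (l : ℕ) ≤ 4 := fun l => Nat.le_of_lt_succ l.is_lt
  -- `K = 4n + 4`, so that the coefficient range is `range (K + 1)`
  obtain ⟨K, hK⟩ : ∃ K, K = 4 * n + 4 := ⟨_, rfl⟩
  have hK1 : 4 * n + 5 = K + 1 := by omega
  rw [hK1] at horth hP hQ
  -- the polynomials `P_l` and `Q = ∑ c_l P_l`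
  set P : Fin 5 → ℚ[X] := fun l => ∑ k ∈ range (K + 1), C (p l k) * X ^ k with hPdef
  have hPcoeff : ∀ (l : Fin 5) (k : ℕ), (P l).coeff k = p l k := by
    intro l k
    simp only [hPdef, finsetSum_coeff, coeff_C_mul_X_pow]
    rw [sum_ite_eq]
    split_ifs with h
    · rfl
    · rw [hvanish l (hl4 l) k (by have := mem_range.not.1 h; omega)]
  set Q : ℚ[X] := ∑ l : Fin 5, C (c l) * P l with hQdef
  have hQcoeff : ∀ k, Q.coeff k = ∑ l : Fin 5, c l * p l k := by
    intro k
    simp only [hQdef, finsetSum_coeff, coeff_C_mul, hPcoeff]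
  -- (a) `Q(z) = 0`, so `Q = (X - z) Q̂`
  have hQz : Q.IsRoot z := by
    rw [IsRoot, hQdef, eval_finsetSum]
    simp only [eval_mul, eval_C, hPdef, eval_finsetSum, eval_pow, eval_X]
    exact hP
  set Qh := Q /ₘ (X - C z) with hQh
  have hQfac : (X - C z) * Qh = Q := mul_divByMonic_eq_iff_isRoot.2 hQz
  -- degrees
  have hPdeg : ∀ l, (P l).natDegree ≤ K := by
    intro l
    refine natDegree_sum_le_of_forall_le _ _ fun k hk => ?_
    refine (natDegree_C_mul_X_pow_le _ _).trans ?_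
    have := mem_range.1 hk
    omega
  have hQdeg : Q.natDegree ≤ K :=
    natDegree_sum_le_of_forall_le _ _ fun l _ => (natDegree_C_mul_le _ _).trans (hPdeg l)
  have hQhdeg : Qh.natDegree ≤ K - 1 := by
    rw [hQh, natDegree_divByMonic _ (monic_X_sub_C z), natDegree_X_sub_C]
    omega
  have hQhK : ∀ k, K ≤ k → Qh.coeff k = 0 := fun k hk =>
    coeff_eq_zero_of_natDegree_lt (by omega)
  -- (b) the orthogonality functionals vanish on `Q` (linearity)
  have hlin : ∀ w : ℕ → ℚ, (∀ l : Fin 5, ∑ k ∈ range (K + 1), p l k * w k = 0) →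
      ∑ k ∈ range (K + 1), Q.coeff k * w k = 0 := by
    intro w hw
    simp only [hQcoeff, sum_mul]
    rw [sum_comm]
    refine sum_eq_zero fun l _ => ?_
    have : ∑ k ∈ range (K + 1), c l * p l k * w k = c l * ∑ k ∈ range (K + 1), p l k * w k := by
      rw [mul_sum]
      exact sum_congr rfl fun k _ => by ring
    rw [this, hw l, mul_zero]
  have hΦQ : ∀ j < n, ∀ s : ℕ, (s = 1 ∨ s = 2) → ∀ α : ℚ, (α = 1 ∨ α = -1) →
      ∑ k ∈ range (K + 1), Q.coeff k * (α ^ (k + j + 1) / ((k : ℚ) + j + 1) ^ s) = 0 := by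
    intro j hj s hs α hα
    refine hlin _ fun l => ?_
    rw [← horth l (hl4 l) j hj s hs α hα]
    exact sum_congr rfl fun k _ => by ring
  -- the row relation `hQ` as a functional on `Q`
  have hΨQ : ∀ α : ℚ, (α = 1 ∨ α = -1) → ∀ s : ℕ, (s = 1 ∨ s = 2) →
      ∑ k ∈ range (K + 1), Q.coeff k *
        (∑ t ∈ range k, z ^ (k - 1 - t) * α ^ (t + 1) / ((t : ℚ) + 1) ^ s) = 0 := by
    intro α hα s hs
    have h := hQ α hα s hs
    simp only [hQcoeff, sum_mul]
    rw [sum_comm, ← h]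
    refine sum_congr rfl fun l _ => ?_
    rw [mul_sum]
    exact sum_congr rfl fun k _ => by ring
  -- (c) transfer to `Q̂`: first the functional with `j = 0`
  have hΦ0 : ∀ s : ℕ, (s = 1 ∨ s = 2) → ∀ α : ℚ, (α = 1 ∨ α = -1) →
      ∑ k ∈ range K, Qh.coeff k * (α ^ (k + 1) / ((k : ℚ) + 1) ^ s) = 0 := by
    intro s hs α hα
    set S : ℕ → ℚ := fun k => ∑ t ∈ range k, z ^ (k - 1 - t) * α ^ (t + 1) / ((t : ℚ) + 1) ^ s
      with hSdef
    have hS : ∀ k, S (k + 1) = z * S k + α ^ (k + 1) / ((k : ℚ) + 1) ^ s := by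
      intro k
      simp only [hSdef]
      rw [sum_range_succ, mul_sum, Nat.add_sub_cancel, Nat.sub_self, pow_zero, one_mul]
      congr 1
      refine sum_congr rfl fun t ht => ?_
      have ht' := mem_range.1 ht
      rw [show k - t = k - 1 - t + 1 by omega, pow_succ]
      ring
    have h1 := sum_coeff_X_sub_C_mul Qh z S K
    rw [hQfac, hΨQ α hα s hs] at h1
    simp only [hS] at h1
    rw [sum_range_succ (fun k => Qh.coeff k * S k), hQhK K le_rfl] at h1
    have h2 : ∑ k ∈ range K, Qh.coeff k * (z * S k + α ^ (k + 1) / ((k : ℚ) + 1) ^ s) =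
        z * ∑ k ∈ range K, Qh.coeff k * S k +
          ∑ k ∈ range K, Qh.coeff k * (α ^ (k + 1) / ((k : ℚ) + 1) ^ s) := by
      rw [mul_sum, ← sum_add_distrib]
      exact sum_congr rfl fun k _ => by ring
    rw [h2] at h1
    linear_combination -h1
  -- then all `j ≤ n` by induction on `j`
  have hΦ : ∀ s : ℕ, (s = 1 ∨ s = 2) → ∀ α : ℚ, (α = 1 ∨ α = -1) → ∀ j ≤ n,
      ∑ k ∈ range K, Qh.coeff k * (α ^ (k + j + 1) / ((k : ℚ) + j + 1) ^ s) = 0 := by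
    intro s hs α hα j
    induction j with
    | zero => intro _; simpa using hΦ0 s hs α hα
    | succ j ih =>
        intro hj
        have hj' : j < n := by omega
        have h1 := sum_coeff_X_sub_C_mul Qh z (fun k => α ^ (k + j + 1) / ((k : ℚ) + j + 1) ^ s) K
        rw [hQfac, hΦQ j hj' s hs α hα] at h1
        rw [sum_range_succ (fun k => Qh.coeff k * _), hQhK K le_rfl, zero_mul, add_zero,
          ih (by omega), mul_zero, sub_zero] at h1
        rw [h1]
        refine sum_congr rfl fun k _ => ?_
        push_cast
        ring_nf
  -- (d) normality: `Q̂ = 0`, hence `Q = 0`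
  have hQh0 : ∀ k, Qh.coeff k = 0 := by
    have hmom := moments_vanish_imp_zero n (q := fun k => Qh.coeff k) (fun j hj s hs α hα => by
      rw [← hK, ← hΦ s hs α hα j hj]
      exact sum_congr rfl fun k _ => by ring)
    intro k
    by_cases hk : k < K
    · exact hmom k (by omega)
    · exact hQhK k (by omega)
  have hQ0 : Q = 0 := by
    rw [← hQfac]
    have : Qh = 0 := by ext k; rw [hQh0 k, coeff_zero]
    rw [this, mul_zero]
  -- (e) `c = 0` by the distinct degrees `4n + l`
  by_contra hc
  have hne : (Finset.univ.filter fun l : Fin 5 => c l ≠ 0).Nonempty := by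
    obtain ⟨l, hl⟩ := Function.ne_iff.1 hc
    exact ⟨l, mem_filter.2 ⟨mem_univ _, hl⟩⟩
  set l₀ := (Finset.univ.filter fun l : Fin 5 => c l ≠ 0).max' hne with hl₀
  have hl₀mem : c l₀ ≠ 0 := (mem_filter.1 (Finset.max'_mem _ hne)).2
  have hmax : ∀ l : Fin 5, c l ≠ 0 → l ≤ l₀ := fun l hl =>
    Finset.le_max' _ l (mem_filter.2 ⟨mem_univ _, hl⟩)
  have hcoeff : Q.coeff (4 * n + l₀) = c l₀ * p l₀ (4 * n + l₀) := by
    rw [hQcoeff]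
    refine sum_eq_single l₀ (fun l _ hl => ?_) (fun h => absurd (mem_univ _) h)
    by_cases hcl : c l = 0
    · rw [hcl, zero_mul]
    · have hlt : (l : ℕ) < l₀ := lt_of_le_of_ne (hmax l hcl) (fun h => hl (Fin.ext h))
      rw [hvanish l (hl4 l) _ (by omega), mul_zero]
  rw [hQ0, coeff_zero] at hcoeff
  exact mul_ne_zero hl₀mem (hlead l₀ (hl4 l₀)) hcoeff.symm

/-! ## The instance: exact degrees of the base polynomials and the assembled independence -/

/-- The base polynomial `T^l (T² − 1)^{2n}` is monic of degree `l + 4n`. [folklore] -/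
theorem monic_basePoly (n l : ℕ) :
    (X ^ l * (X ^ 2 - 1) ^ (2 * n) : ℚ[X]).Monic ∧
      (X ^ l * (X ^ 2 - 1) ^ (2 * n) : ℚ[X]).natDegree = l + 4 * n := by
  have h1 : (X ^ 2 - 1 : ℚ[X]) = X ^ 2 - C 1 := by rw [C_1]
  have hm : (X ^ 2 - 1 : ℚ[X]).Monic := by rw [h1]; exact monic_X_pow_sub_C _ two_ne_zero
  have hd : (X ^ 2 - 1 : ℚ[X]).natDegree = 2 := by rw [h1, natDegree_X_pow_sub_C]
  refine ⟨(monic_X_pow l).mul (hm.pow _), ?_⟩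
  rw [(monic_X_pow l).natDegree_mul (hm.pow _), natDegree_X_pow, hm.natDegree_pow, hd]
  ring

/-- The leading coefficient: `a_{4n+l} = 1`, so `p_{l,4n+l} = C(5n+l, n)² ≠ 0`. [folklore] -/
theorem padeCoeff_lead_ne_zero (n l : ℕ) :
    (((X ^ l * (X ^ 2 - 1) ^ (2 * n) : ℤ[X]).coeff (4 * n + l) : ℤ) : ℚ) *
      ((4 * n + l + n).choose n : ℚ) ^ 2 ≠ 0 := by
  rw [cast_coeff_basePoly]
  obtain ⟨hm, hd⟩ := monic_basePoly n l
  have hlc : (X ^ l * (X ^ 2 - 1) ^ (2 * n) : ℚ[X]).coeff (4 * n + l) = 1 := by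
    rw [show 4 * n + l = l + 4 * n by ring, ← hd]
    exact hm
  rw [hlc, one_mul]
  exact pow_ne_zero _ (by exact_mod_cast (Nat.choose_pos (by omega)).ne')

/-- Above the degree the coefficients vanish: `p_{l,k} = 0` for `k > 4n + l`. [folklore] -/
theorem padeCoeff_eq_zero_of_lt (n l : ℕ) {k : ℕ} (hk : 4 * n + l < k) :
    (((X ^ l * (X ^ 2 - 1) ^ (2 * n) : ℤ[X]).coeff k : ℤ) : ℚ) * ((k + n).choose n : ℚ) ^ 2 = 0 := by
  rw [cast_coeff_basePoly, coeff_eq_zero_of_natDegree_lt (by rw [(monic_basePoly n l).2]; omega),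
    zero_mul]

/-- **Non-vanishing of the Padé determinant for `1, Li₁(±1/z), Li₂(±1/z)`**
([DavidHirataKohnoKawashima2020, Prop 5.1] for `x = 0`, `r = m = 2`, `α = (1, −1)`, any rational
`z`): with `p_{l,k} = C(k+n,n)² a_{l,k}`, `a_{l,k}` the coefficients of `T^l (T²−1)^{2n}`, the five
rows `(∑_k p_{l,k} z^k, (∑_k p_{l,k} ∑_{t<k} z^{k−1−t} α^{t+1}/(t+1)^s)_{(α,s)})`, `l = 0,…,4`,
`(α, s) ∈ {1,−1} × {1,2}`, are linearly independent over `ℚ`.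
[cite: DavidHirataKohnoKawashima2020, Prop 5.1] -/
theorem pade_rows_independent_inst (n : ℕ) (z : ℚ) (c : Fin 5 → ℚ)
    (hP : ∑ l : Fin 5, c l * ∑ k ∈ range (4 * n + 5),
      (((X ^ (l : ℕ) * (X ^ 2 - 1) ^ (2 * n) : ℤ[X]).coeff k : ℤ) : ℚ) * ((k + n).choose n : ℚ) ^ 2 *
        z ^ k = 0)
    (hQ : ∀ α : ℚ, (α = 1 ∨ α = -1) → ∀ s : ℕ, (s = 1 ∨ s = 2) →
      ∑ l : Fin 5, c l * ∑ k ∈ range (4 * n + 5),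
        (((X ^ (l : ℕ) * (X ^ 2 - 1) ^ (2 * n) : ℤ[X]).coeff k : ℤ) : ℚ) * ((k + n).choose n : ℚ) ^ 2 *
          ∑ t ∈ range k, z ^ (k - 1 - t) * α ^ (t + 1) / ((t : ℚ) + 1) ^ s = 0) :
    c = 0 :=
  pade_rows_independent n
    (p := fun l k => (((X ^ l * (X ^ 2 - 1) ^ (2 * n) : ℤ[X]).coeff k : ℤ) : ℚ) *
      ((k + n).choose n : ℚ) ^ 2)
    (fun l hl j hj s hs α hα => pade_orthogonality n l hl hj (by rcases hs with rfl | rfl <;> norm_num)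
      (by rcases hs with rfl | rfl <;> norm_num) hα)
    (fun l _ => padeCoeff_lead_ne_zero n l)
    (fun l _ k hk => padeCoeff_eq_zero_of_lt n l hk) z c hP hQ

end DilogTwoPoints

end Literature.NumberTheory.DiophantineApproximation
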